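import Summits.NavierStokesRegularity.NavierStokesRegularity.Theses.RellichScar
import Summits.NavierStokesRegularity.NavierStokesRegularity.Theorems.ScarRigidity.Negative.LogicAndLoadBearing
import Literature.Analysis.FluidPDE.TypeIAncientMild
import Literature.Analysis.FluidPDE.ParasiticSlabFlow
import Literature.Analysis.FluidPDE.KNSSLiouville
import Literature.Analysis.FluidPDE.DistributionalToWeak
import Literature.Analysis.FluidPDE.HeatDuhamelBack
import Literature.Analysis.FluidPDE.WeakSolutionProofs
import HarnessLib

/-!
# `ScarRigidity`, line `finite-energy-log-convexity`, stub `stub_apexMildRepresentative` —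
# helper file 1: bounded distributional solutions on the slab are KNSS bounded weak solutions

Support file (everything proved) for the stub `stub_apexMildRepresentative` of crux
stmt-NavierStokesRegularity-11717 (route RellichScar). A distributional (pressure-explicit)
Navier–Stokes solution `(u, p)` on the backward slab `(-∞, 0) × ℝ³` (`ν = 1`, `f = 0`) which is
pointwise bounded on a window `(a, b)`, `b ≤ 0`, is a bounded weak solution on `ℝ³ × (a, b)` in
the sense of Koch–Nadirashvili–Seregin–Šverák 2009, §4 (ii) (`IsBoundedWeakNSSolutionOn`): the
pressure term drops against divergence-free test fields, the space–time divergence condition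
gives weakly divergence-free slices for a.e. time (Fubini and the fundamental lemma of the
calculus of variations in `t`), and the set integral over the slab is an iterated integral
(Fubini for a bounded field against compactly supported test fields).
-/

noncomputable section

open Set Filter Function MeasureTheory Metric TopologicalSpace
open scoped Topology ENNReal NNReal InnerProductSpace RealInnerProductSpace Laplacian
open Literature.Analysis.FluidPDE
open Summit.NavierStokesRegularity.NavierStokesRegularity.Theses.RellichScar
open Summit.NavierStokesRegularity.NavierStokesRegularity.Theorems.ScarRigidity.Negative

set_option linter.dupNamespace false

namespace Summit.NavierStokesRegularity.NavierStokesRegularity.Theorems.RellichScarScarRigidity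

/-! ## Bounded distributional solutions on the slab are KNSS bounded weak solutions on windows -/

section WeakBridge

variable {E : Type*} [NormedAddCommGroup E] [InnerProductSpace ℝ E] [FiniteDimensional ℝ E]
  [MeasurableSpace E] [BorelSpace E]
variable {u : ℝ → E → E} {p : ℝ → E → ℝ} {a b K : ℝ}

/-- Joint a.e. strong measurability of a distributional solution on a sub-window of the slab, in
product form. [folklore] -/
theorem aestronglyMeasurable_window_of_distributional
    (hNS : IsDistributionalNSSolutionOn (slab E (Iio (0 : ℝ)) isOpen_Iio) 1 0 u p)
    (hb : b ≤ 0) :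
    AEStronglyMeasurable (uncurry u)
      ((volume.restrict (Ioo a b)).prod (volume : Measure E)) := by
  have hsub : Ioo a b ×ˢ (univ : Set E) ⊆ Iio 0 ×ˢ univ :=
    prod_mono (fun t ht => lt_of_lt_of_le ht.2 hb) Subset.rfl
  have h1 : AEStronglyMeasurable (uncurry u)
      (volume.restrict (Iio (0 : ℝ) ×ˢ (univ : Set E))) :=
    hNS.1.aestronglyMeasurable
  rw [Measure.restrict_prod_eq_prod_univ, ← Measure.volume_eq_prod]
  exact h1.mono_measure (Measure.restrict_mono hsub le_rfl)

/-- **Weakly divergence-free slices for a.e. time** of a bounded distributional solution on a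
window: test the space–time divergence condition with `η(t) θ(x)`, use Fubini and the fundamental
lemma of the calculus of variations in `t`, then `ae_isWeaklyDivFree_of_forall_test`
(Robinson–Rodrigo–Sadowski 2016, proof of Prop. 5.3). [folklore] -/
theorem ae_isWeaklyDivFree_window_of_distributional
    (hNS : IsDistributionalNSSolutionOn (slab E (Iio (0 : ℝ)) isOpen_Iio) 1 0 u p)
    (hb : b ≤ 0) (hK : ∀ t ∈ Ioo a b, ∀ x, ‖u t x‖ ≤ K) :
    ∀ᵐ t ∂(volume.restrict (Ioo a b)), IsWeaklyDivFree (u t) := by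
  have hIsub : Ioo a b ⊆ Iio (0 : ℝ) := fun t ht => lt_of_lt_of_le ht.2 hb
  have hK' : ∀ t ∈ Ioo a b, ∀ x, ‖u t x‖ ≤ max K 0 := fun t ht x =>
    (hK t ht x).trans (le_max_left _ _)
  have hmeasP := aestronglyMeasurable_window_of_distributional (a := a) hNS hb
  haveI : IsFiniteMeasure (volume.restrict (Ioo a b)) :=
    isFiniteMeasure_restrict.2 measure_Ioo_lt_top.ne
  refine ae_isWeaklyDivFree_of_forall_test ?_ ?_
  · filter_upwards [hmeasP.prodMk_left, ae_restrict_mem measurableSet_Ioo] with t ht htI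
    refine ⟨ht, fun n => ?_⟩
    have hle : ∀ x, ‖u t x‖ₑ ^ 2 ≤ ENNReal.ofReal (max K 0) ^ 2 := fun x => by
      gcongr
      rw [← ofReal_norm]
      exact ENNReal.ofReal_le_ofReal (hK' t htI x)
    calc ∫⁻ x in closedBall (0 : E) n, ‖u t x‖ₑ ^ 2
        ≤ ∫⁻ _ in closedBall (0 : E) n, ENNReal.ofReal (max K 0) ^ 2 :=
          lintegral_mono fun x => hle x
      _ = ENNReal.ofReal (max K 0) ^ 2 * volume (closedBall (0 : E) n) := by
          rw [setLIntegral_const]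
      _ < ∞ := ENNReal.mul_lt_top (ENNReal.pow_lt_top ENNReal.ofReal_lt_top)
          measure_closedBall_lt_top
  · intro θ hθ
    have hgc : Continuous (gradient θ) :=
      continuous_gradient_of_contDiff (contDiff_infty.1 hθ.contDiff 1)
    have hgK : HasCompactSupport (gradient θ) :=
      HasCompactSupport.intro hθ.hasCompactSupport fun x hx =>
        gradient_eq_zero_of_notMem_tsupport hx
    have hgi : Integrable (gradient θ) := hgc.integrable_of_hasCompactSupport hgK
    set F : ℝ × E → ℝ := fun z => ⟪u z.1 z.2, gradient θ z.2⟫ with hF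
    have hFm : AEStronglyMeasurable F
        ((volume.restrict (Ioo a b)).prod (volume : Measure E)) :=
      hmeasP.inner (hgc.comp continuous_snd).aestronglyMeasurable
    have hFi : Integrable F
        ((volume.restrict (Ioo a b)).prod (volume : Measure E)) := by
      refine Integrable.mono' ((integrable_const (max K 0)).mul_prod hgi.norm) hFm ?_
      rw [Measure.restrict_prod_eq_prod_univ, ← Measure.volume_eq_prod]
      filter_upwards [ae_restrict_mem (measurableSet_Ioo.prod MeasurableSet.univ)] with z hz
      exact (norm_inner_le_norm _ _).trans
        (mul_le_mul_of_nonneg_right (hK' z.1 hz.1 z.2) (norm_nonneg _))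
    have hg : IntegrableOn (fun t => ∫ x, F (t, x)) (Ioo a b) volume := hFi.integral_prod_left
    have hloc : LocallyIntegrableOn (fun t => ∫ x, F (t, x)) (Ioo a b) volume :=
      hg.locallyIntegrableOn
    have key := IsOpen.ae_eq_zero_of_integral_contDiff_smul_eq_zero isOpen_Ioo
      (μ := (volume : Measure ℝ)) (f := fun t => ∫ x, F (t, x)) hloc ?_
    · exact (ae_restrict_iff' measurableSet_Ioo).2 key
    intro η hη hηc hηI
    obtain ⟨C, hC⟩ := hη.continuous.bounded_above_of_compact_support hηc
    have hC' : ∀ s, |η s| ≤ C := fun s => by simpa [Real.norm_eq_abs] using hC s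
    have hηz : ∀ s, s ∉ Ioo a b → η s = 0 := fun s hs => by
      by_contra hne
      exact hs (hηI (subset_tsupport _ hne))
    -- the tested identity with `Θ = η ⊗ θ`
    have hΘ : IsSpaceTimeTestOn (slab E (Ioo a b) isOpen_Ioo)
        (fun s x => η s • θ x) :=
      isSpaceTimeTestOn_slab_smul isOpen_Ioo hη hηc hηI hθ
    have h0 := hNS.2.2.2.1 _ (hΘ.mono (slab_mono hIsub))
    have hθd : Differentiable ℝ θ := hθ.contDiff.differentiable (by simp)
    have hgrad : ∀ s x, gradient (fun x => η s • θ x) x = η s • gradient θ x := by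
      intro s x
      rw [gradient, gradient, show (fun x => η s • θ x) = fun x => η s * θ x from rfl,
        fderiv_const_mul (hθd x), map_smul]
    simp_rw [hgrad, real_inner_smul_right] at h0
    rw [coe_slab] at h0
    -- `h0 : ∫ z in Iio 0 ×ˢ univ, η z.1 * F z = 0`; pass to the window and apply Fubini
    have h1 : ∫ z in Iio (0 : ℝ) ×ˢ (univ : Set E), η z.1 * F z =
        ∫ z in Ioo a b ×ˢ (univ : Set E), η z.1 * F z := by
      refine setIntegral_eq_of_subset_of_forall_sdiff_eq_zero
        (measurableSet_Iio.prod MeasurableSet.univ) (prod_mono hIsub Subset.rfl) fun z hz => ?_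
      rw [hηz z.1 fun h => hz.2 ⟨h, mem_univ _⟩, zero_mul]
    have hηF : Integrable (fun z : ℝ × E => η z.1 * F z)
        ((volume.restrict (Ioo a b)).prod (volume : Measure E)) :=
      integrable_time_mul hFi hη.continuous hC'
    have h2 : ∫ z in Ioo a b ×ˢ (univ : Set E), η z.1 * F z =
        ∫ t in Ioo a b, η t * ∫ x, F (t, x) := by
      rw [Measure.volume_eq_prod, ← Measure.restrict_prod_eq_prod_univ, integral_prod _ hηF]
      simp_rw [integral_const_mul]
    have h3 : ∫ t, η t • ∫ x, F (t, x) = ∫ t in Ioo a b, η t * ∫ x, F (t, x) := by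
      simp_rw [smul_eq_mul]
      exact (setIntegral_eq_integral_of_forall_compl_eq_zero fun t ht => by
        rw [hηz t ht, zero_mul]).symm
    rw [h3, ← h2, ← h1]
    exact h0

/-- The KNSS integrand `⟪u, ∂ₜψ⟫ + ⟪u, (u·∇)ψ⟫ + 1·⟪u, Δψ⟫` of a bounded jointly measurable field
against a test field `ψ` on the window slab is integrable on `(a, b) × ℝ³` (it is dominated by a
continuous compactly supported function). [folklore] -/
theorem integrable_knssIntegrand_window
    (hmeasP : AEStronglyMeasurable (uncurry u)
      ((volume.restrict (Ioo a b)).prod (volume : Measure E)))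
    (hK : ∀ t ∈ Ioo a b, ∀ x, ‖u t x‖ ≤ K) {ψ : ℝ → E → E}
    (hψ : IsSpaceTimeTestOn (⊤ : Opens (ℝ × E)) ψ) :
    Integrable (fun z : ℝ × E => ⟪u z.1 z.2, timeDeriv ψ z.1 z.2⟫ +
        ⟪u z.1 z.2, convect (u z.1) (ψ z.1) z.2⟫ + 1 * ⟪u z.1 z.2, Δ (ψ z.1) z.2⟫)
      ((volume.restrict (Ioo a b)).prod (volume : Measure E)) := by
  have hK' : ∀ t ∈ Ioo a b, ∀ x, ‖u t x‖ ≤ max K 0 := fun t ht x =>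
    (hK t ht x).trans (le_max_left _ _)
  have h1 := hψ.timeDeriv_top
  have h2 := hψ.fderiv_top
  have h3 := hψ.laplacian_top
  have happ := (isBoundedBilinearMap_apply (𝕜 := ℝ) (E := E)
    (F := E)).continuous
  -- the dominating function
  set B : ℝ × E → ℝ := fun z => max K 0 * ‖timeDeriv ψ z.1 z.2‖ +
    max K 0 * (max K 0 * ‖fderiv ℝ (ψ z.1) z.2‖) + max K 0 * ‖Δ (ψ z.1) z.2‖ with hB
  have hBc : Continuous B :=
    ((continuous_const.mul h1.continuous_uncurry.norm).add
      (continuous_const.mul (continuous_const.mul h2.continuous_uncurry.norm))).add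
      (continuous_const.mul h3.continuous_uncurry.norm)
  have hBK : HasCompactSupport B :=
    ((h1.hasCompactSupport.norm.mul_left).add (h2.hasCompactSupport.norm.mul_left.mul_left)).add
      h3.hasCompactSupport.norm.mul_left
  have hBi : Integrable B
      ((volume.restrict (Ioo a b)).prod (volume : Measure E)) := by
    have h : Integrable B (volume : Measure (ℝ × E)) :=
      hBc.integrable_of_hasCompactSupport hBK
    rw [Measure.restrict_prod_eq_prod_univ, ← Measure.volume_eq_prod]
    exact h.mono_measure Measure.restrict_le_self
  have hm : AEStronglyMeasurable (fun z : ℝ × E => ⟪u z.1 z.2, timeDeriv ψ z.1 z.2⟫ +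
      ⟪u z.1 z.2, convect (u z.1) (ψ z.1) z.2⟫ + 1 * ⟪u z.1 z.2, Δ (ψ z.1) z.2⟫)
      ((volume.restrict (Ioo a b)).prod (volume : Measure E)) := by
    refine ((hmeasP.inner h1.continuous_uncurry.aestronglyMeasurable).add
      (hmeasP.inner (happ.comp_aestronglyMeasurable
        (h2.continuous_uncurry.aestronglyMeasurable.prodMk hmeasP)))).add
      (aestronglyMeasurable_const.mul (hmeasP.inner h3.continuous_uncurry.aestronglyMeasurable))
  refine Integrable.mono' hBi hm ?_
  rw [Measure.restrict_prod_eq_prod_univ, ← Measure.volume_eq_prod]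
  filter_upwards [ae_restrict_mem (measurableSet_Ioo.prod MeasurableSet.univ)] with z hz
  have hu : ‖u z.1 z.2‖ ≤ max K 0 := hK' z.1 hz.1 z.2
  refine (norm_add_le _ _).trans (add_le_add ((norm_add_le _ _).trans (add_le_add ?_ ?_)) ?_)
  · exact (norm_inner_le_norm _ _).trans (mul_le_mul_of_nonneg_right hu (norm_nonneg _))
  · refine (norm_inner_le_norm _ _).trans (mul_le_mul hu ?_ (norm_nonneg _) (le_max_right _ _))
    rw [convect_apply]
    exact (ContinuousLinearMap.le_opNorm _ _).trans
      ((mul_comm _ _).le.trans (mul_le_mul_of_nonneg_right hu (norm_nonneg _)))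
  · rw [norm_mul, norm_one, one_mul]
    exact (norm_inner_le_norm _ _).trans (mul_le_mul_of_nonneg_right hu (norm_nonneg _))

/-- **Bounded distributional solutions on the slab are KNSS bounded weak solutions on windows.**
If `(u, p)` solves Navier–Stokes (`ν = 1`, `f = 0`) in the sense of distributions on the slab
`(-∞, 0) × ℝ³` and `u` is pointwise bounded on `(a, b) × ℝ³`, `b ≤ 0`, then `u` is a bounded weak
solution on `ℝ³ × (a, b)` in the sense of Koch–Nadirashvili–Seregin–Šverák 2009, §4 (ii): against
a test field with divergence-free slices the pressure term `∫∫ p div ψ` vanishes, and the slab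
integral is the iterated one. [cite: KochNadirashviliSereginSverak2009, §4 p. 8 (ii) (arXiv:0709.3599)] -/
theorem isBoundedWeakNSSolutionOn_window_of_distributional
    (hNS : IsDistributionalNSSolutionOn (slab E (Iio (0 : ℝ)) isOpen_Iio) 1 0 u p)
    (hb : b ≤ 0)
    (hK : ∀ t ∈ Ioo a b, ∀ x, ‖u t x‖ ≤ K) :
    IsBoundedWeakNSSolutionOn (Ioo a b) isOpen_Ioo 1 u := by
  have hIsub : Ioo a b ⊆ Iio (0 : ℝ) := fun t ht => lt_of_lt_of_le ht.2 hb
  have hmeasP := aestronglyMeasurable_window_of_distributional (a := a) hNS hb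
  have hmeas : AEStronglyMeasurable (uncurry u)
      (volume.restrict (Ioo a b ×ˢ (univ : Set E))) := by
    rw [Measure.volume_eq_prod, ← Measure.restrict_prod_eq_prod_univ]
    exact hmeasP
  refine ⟨hmeas, ⟨K, hK⟩, ae_isWeaklyDivFree_window_of_distributional hNS hb hK,
    fun ψ hψ hdiv => ?_⟩
  have h0 := hNS.2.2.2.2 ψ (hψ.mono (slab_mono hIsub))
  rw [coe_slab] at h0
  set Φ : ℝ × E → ℝ := fun z => ⟪u z.1 z.2, timeDeriv ψ z.1 z.2⟫ +
    ⟪u z.1 z.2, convect (u z.1) (ψ z.1) z.2⟫ + 1 * ⟪u z.1 z.2, Δ (ψ z.1) z.2⟫ with hΦ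
  -- the pressure and force terms drop
  have h0' : ∫ z in Iio (0 : ℝ) ×ˢ (univ : Set E), Φ z = 0 := by
    refine Eq.trans (setIntegral_congr_fun (measurableSet_Iio.prod MeasurableSet.univ)
      fun z _ => ?_) h0
    simp only [hΦ, hdiv z.1 z.2, mul_zero, add_zero, Pi.zero_apply, inner_zero_left]
  -- the integrand lives on the window slab
  have hvan : ∀ z : ℝ × E,
      z ∉ Ioo a b ×ˢ (univ : Set E) → Φ z = 0 := fun z hz => by
    have hz' : (z.1, z.2) ∉ ((slab E (Ioo a b) isOpen_Ioo :
        Opens (ℝ × E)) : Set (ℝ × E)) := hz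
    simp only [hΦ, timeDeriv_apply, hψ.deriv_eq_zero hz', convect_apply,
      hψ.fderiv_slice_eq_zero hz', hψ.laplacian_slice_eq_zero hz', inner_zero_right,
      zero_apply, mul_zero, add_zero]
  have h1 : ∫ z in Iio (0 : ℝ) ×ˢ (univ : Set E), Φ z =
      ∫ z in Ioo a b ×ˢ (univ : Set E), Φ z :=
    setIntegral_eq_of_subset_of_forall_sdiff_eq_zero (measurableSet_Iio.prod MeasurableSet.univ)
      (prod_mono hIsub Subset.rfl) fun z hz => hvan z hz.2
  have hΦi : Integrable Φ
      ((volume.restrict (Ioo a b)).prod (volume : Measure E)) :=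
    integrable_knssIntegrand_window hmeasP hK (hψ.mono le_top)
  have h2 : ∫ z in Ioo a b ×ˢ (univ : Set E), Φ z =
      ∫ t in Ioo a b, ∫ x, Φ (t, x) := by
    rw [Measure.volume_eq_prod, ← Measure.restrict_prod_eq_prod_univ, integral_prod _ hΦi]
  have h3 := h0'
  rw [h1, h2] at h3
  simpa only [hΦ] using h3

/-- **Apex profiles are KNSS bounded weak solutions on every window `(a, b)`, `b < 0`**, with the
bound `C/√(-b)`: a suitable weak solution on the slab with the apex bound `‖u‖ ≤ C/(‖x‖ + √(-t))`
is bounded by `C/√(-b)` on `(a, b) × ℝ³` and solves Navier–Stokes in distributions there. [cite: KochNadirashviliSereginSverak2009, §4 p. 8 (ii) (arXiv:0709.3599)] -/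
theorem isBoundedWeakNSSolutionOn_window_of_apex {C : ℝ}
    (hsw : IsSuitableWeakSolutionOn (slab E (Iio (0 : ℝ)) isOpen_Iio) 1 0 u p)
    (hd : HasTypeIDecay C u) (hb : b < 0) :
    IsBoundedWeakNSSolutionOn (Ioo a b) isOpen_Ioo 1 u ∧
      ∀ t ∈ Ioo a b, ∀ x, ‖u t x‖ ≤ C / Real.sqrt (-b) := by
  have hC : 0 ≤ C := by
    have h := hd (-1) (by norm_num) 0
    rw [norm_zero, zero_add, neg_neg, Real.sqrt_one, div_one] at h
    exact (norm_nonneg _).trans h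
  have hK : ∀ t ∈ Ioo a b, ∀ x, ‖u t x‖ ≤ C / Real.sqrt (-b) := fun t ht x => by
    refine (hd.hasTypeITimeDecay hC t (ht.2.trans hb) x).trans ?_
    exact div_le_div_of_nonneg_left hC (Real.sqrt_pos.2 (by linarith))
      (Real.sqrt_le_sqrt (by linarith [ht.2]))
  exact ⟨isBoundedWeakNSSolutionOn_window_of_distributional hsw.distributional hb.le hK, hK⟩

end WeakBridge

/-! ## Registered sub-goal (helper stub of `stub_apexMildRepresentative`) -/

/-- **Registered helper stub `stub_apexMildWindowWeak`** (sub-goal of `stub_apexMildRepresentative`,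
crux stmt-NavierStokesRegularity-11717): an apex profile — a suitable weak solution on the slab
`(-∞, 0) × ℝ³` with the space–time Type-I bound `‖u‖ ≤ C/(‖x‖ + √(-t))` — is, on every window
`(a, b)` with `b < 0`, a bounded weak solution in the sense of KNSS 2009, §4 (ii), bounded by
`C/√(-b)`. [cite: KochNadirashviliSereginSverak2009, §4 p. 8 (ii) (arXiv:0709.3599)] -/
theorem stub_apexMildWindowWeak :
    ∀ (u : ℝ → EuclideanSpace ℝ (Fin 3) → EuclideanSpace ℝ (Fin 3)) (p : ℝ → EuclideanSpace ℝ (Fin 3) → ℝ)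
      (C a b : ℝ), IsSuitableWeakSolutionOn (slab (EuclideanSpace ℝ (Fin 3)) (Iio (0 : ℝ)) isOpen_Iio) 1 0 u p →
      HasTypeIDecay C u → b < 0 →
      IsBoundedWeakNSSolutionOn (Ioo a b) isOpen_Ioo 1 u ∧
        ∀ t ∈ Ioo a b, ∀ x : EuclideanSpace ℝ (Fin 3), ‖u t x‖ ≤ C / Real.sqrt (-b) :=
  fun _ _ _ _ _ hsw hd hb => isBoundedWeakNSSolutionOn_window_of_apex hsw hd hb


end Summit.NavierStokesRegularity.NavierStokesRegularity.Theorems.RellichScarScarRigidity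

end
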